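/-
Copyright: the b2b-balaban T⁴-continuum CRUX team, row NE7b OWNER lineage `t4-ne7b-p1` (gen 142). Project licence.
-/
import Summits.QuantumFields.BalabanUV.T4Continuum.Spine.NE7b.SupTruncationGroupBound

/-!
# TRUNCATION AT ORDER FIVE: THE FIVE-FACTOR CLAMP DEFECT NEEDS ONLY SIXTH MOMENTS (SCOPING (d14)(2)(ii), first analytic order-five file — the
# order-5 analogue of (460)∕(486)).  The fifteen cut bounds of the fifth cumulant (memo SCOPING-d14; algebra (540), threshold∕tree (537)–(539)) are
# covariances of PRODUCTS of centred class observables across a cut — `Cov(f₁, f₂f₃f₄f₅)` and `Cov(f₁f₂, f₃f₄f₅)` — and neither side is Lipschitz.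
# Clamp EVERY factor at level `R` (`T_Ru = max(−R, min(R,u))`): the clamped products are bounded and Lipschitz ((461)∕(489) vectors `R^{k−1}·Σa`),
# Dobrushin applies to them, and THIS FILE prices the defect with SIXTH moments only:
#   `|abcde − T_Ra·T_Rb·T_Rc·T_Rd·T_Re| ≤ (a⁶ + b⁶ + c⁶ + d⁶ + e⁶)∕R`
# (telescoping; `|u − T_Ru|·R ≤ u²`; the weighted mean `a²|b||c||d||e| ≤ (2a⁶ + b⁶ + c⁶ + d⁶ + e⁶)∕6` from two squares and four cubes), hence
# `|E[f₁⋯f₅] − E[T f₁⋯T f₅]| ≤ Σ_iE[f_i⁶]∕R`; and the re-centring cost of a clamp, `|E[T_Rf]| ≤ E[f²]∕R` when `E[f] = 0`.  So ORDER FIVE NEEDS NO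
# EIGHTH MOMENT: (505)'s sixth-moment letter suffices (row NE7b, node U5c; (486) `amgm_cubes` BY NAME; Mathlib measure theory; [folklore])

Cell `pub-balaban`, sub-cell `t4`, spine estimate NE7b (`T4WeightBudget.RelWeightBound`; the cell's OWN estimate — NOT PRINTED in
[Bałaban 1983–89], NOT PROVED).  Crux-route work under `Spine/NE7b/` by the row OWNER (`t4-ne7b-p1` gen 142, file (541)) under FREEZE
(0)'s crux-prover clause; NOTHING of Bałaban's is named as a Lean object, valued or asserted; no `T4Continuum/Support` leaf typed; no
`def`, no notation (the clamp WRITTEN OUT as `max (-R) (min R ·)`); zero `sorry`.  Imports (BY NAME): the OWNER's (486) `…SupTruncationGroupBound`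
(`amgm_cubes`, `integrable_sq_of_quartic`).

WHAT IS PROVED ([folklore]):
* §1 pointwise: `sq_mul_abs_four_le`, `abs_quint_le`, **`quint_sub_clamp_quint_abs_le`**.
* §2 expectations (probability measure; fourth and sixth moments integrable): `integrable_quint`, `integrable_quint_clamped`,
  **`quint_expect_defect_le`** (`|∫Πf − ∫ΠT_Rf| ≤ Σ∫f⁶∕R`), **`abs_expect_clamp_le`** (`∫f = 0 ⟹ |∫T_Rf| ≤ ∫f²∕R`); §3 toy.

HONEST (what this is NOT).  Real inequalities and their integrals; the Dobrushin bounds for the clamped `(1,4)` and `(2,3)` pairs, the fifteen cut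
bounds, the whitened instantiation and the fifth cumulant's kernel letter are the next files; the cumulant FORM of `∂⁵W` is NOT typed; scalar
skeleton ((A3), NC-NE7b-α UNRULED); nothing of Bałaban's asserted.  BY-NAME EFFECT ON THE WALL: NONE.  NE7b NOT PRINTED ∕ NOT PROVED; spine
PROVED 0∕9; rung (B)+1 — FINITE-torus statements; NOT the mass gap, NOT Clay.  HONEST DEPENDENCY: continuum YM on T⁴ ⇐ BetaPertH ∧ nine spine
estimates (0∕9 proved); BetaPertH ⇐ (D1) ∧ (D4) ∧ CAP+tail; G-an2-4 gates asym, D1 and NE2∕3∕4.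
-/

set_option autoImplicit false

noncomputable section

namespace Summit.QuantumFields.BalabanUV.T4Continuum.NE7b.SupTruncationFiveBound

open MeasureTheory Real
open SupTruncationGroupBound (amgm_cubes integrable_sq_of_quartic)

/-! ## §1. Pointwise inequalities -/

/-- **The weighted mean of degree six**: `a²|b||c||d||e| ≤ (2a⁶ + b⁶ + c⁶ + d⁶ + e⁶)∕6` (two squares, then four cubes). [folklore] -/
theorem sq_mul_abs_four_le (a b c d e : ℝ) : a ^ 2 * |b| * |c| * |d| * |e| ≤ (2 * a ^ 6 + b ^ 6 + c ^ 6 + d ^ 6 + e ^ 6) / 6 := by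
  have hbc : |b| * |c| ≤ (b ^ 2 + c ^ 2) / 2 := by nlinarith [sq_nonneg (|b| - |c|), sq_abs b, sq_abs c]
  have hde : |d| * |e| ≤ (d ^ 2 + e ^ 2) / 2 := by nlinarith [sq_nonneg (|d| - |e|), sq_abs d, sq_abs e]
  have step : a ^ 2 * |b| * |c| * |d| * |e| ≤ a ^ 2 * ((b ^ 2 + c ^ 2) / 2 * ((d ^ 2 + e ^ 2) / 2)) := by
    have h := mul_le_mul hbc hde (by positivity) (by positivity)
    calc a ^ 2 * |b| * |c| * |d| * |e| = a ^ 2 * (|b| * |c| * (|d| * |e|)) := by ring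
      _ ≤ a ^ 2 * ((b ^ 2 + c ^ 2) / 2 * ((d ^ 2 + e ^ 2) / 2)) := mul_le_mul_of_nonneg_left h (sq_nonneg a)
  have expand : a ^ 2 * ((b ^ 2 + c ^ 2) / 2 * ((d ^ 2 + e ^ 2) / 2)) =
      (a ^ 2 * b ^ 2 * d ^ 2 + a ^ 2 * b ^ 2 * e ^ 2 + a ^ 2 * c ^ 2 * d ^ 2 + a ^ 2 * c ^ 2 * e ^ 2) / 4 := by ring
  have e6 : ∀ x : ℝ, (x ^ 2) ^ 3 = x ^ 6 := fun x => by ring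
  have c1 := amgm_cubes (sq_nonneg a) (sq_nonneg b) (sq_nonneg d)
  have c2 := amgm_cubes (sq_nonneg a) (sq_nonneg b) (sq_nonneg e)
  have c3 := amgm_cubes (sq_nonneg a) (sq_nonneg c) (sq_nonneg d)
  have c4 := amgm_cubes (sq_nonneg a) (sq_nonneg c) (sq_nonneg e)
  rw [e6, e6, e6] at c1 c2 c3 c4
  rw [expand] at step
  linarith

/-- `|abcde| ≤ ((a⁶+b⁶+c⁶)∕3 + (d⁴+e⁴)∕2)∕2` (a square, a cube mean and a square mean — fourth and sixth powers only). [folklore] -/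
theorem abs_quint_le (a b c d e : ℝ) : |a * b * c * d * e| ≤ ((a ^ 6 + b ^ 6 + c ^ 6) / 3 + (d ^ 4 + e ^ 4) / 2) / 2 := by
  rw [abs_mul, abs_mul, abs_mul, abs_mul]
  have h1 : |a| * |b| * |c| * (|d| * |e|) ≤ ((|a| * |b| * |c|) ^ 2 + (|d| * |e|) ^ 2) / 2 := by
    nlinarith [sq_nonneg (|a| * |b| * |c| - |d| * |e|)]
  have h2 : (|a| * |b| * |c|) ^ 2 ≤ (a ^ 6 + b ^ 6 + c ^ 6) / 3 := by
    have h := amgm_cubes (sq_nonneg a) (sq_nonneg b) (sq_nonneg c)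
    have eq1 : (|a| * |b| * |c|) ^ 2 = a ^ 2 * b ^ 2 * c ^ 2 := by rw [mul_pow, mul_pow, sq_abs, sq_abs, sq_abs]
    rw [eq1]
    calc a ^ 2 * b ^ 2 * c ^ 2 ≤ ((a ^ 2) ^ 3 + (b ^ 2) ^ 3 + (c ^ 2) ^ 3) / 3 := h
      _ = (a ^ 6 + b ^ 6 + c ^ 6) / 3 := by ring
  have h3 : (|d| * |e|) ^ 2 ≤ (d ^ 4 + e ^ 4) / 2 := by
    have eq2 : (|d| * |e|) ^ 2 = d ^ 2 * e ^ 2 := by rw [mul_pow, sq_abs, sq_abs]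
    rw [eq2]; nlinarith [sq_nonneg (d ^ 2 - e ^ 2)]
  calc |a| * |b| * |c| * |d| * |e| = |a| * |b| * |c| * (|d| * |e|) := by ring
    _ ≤ ((a ^ 6 + b ^ 6 + c ^ 6) / 3 + (d ^ 4 + e ^ 4) / 2) / 2 := by linarith

/-- **THE FIVE-FACTOR CLAMP DEFECT**: for `R > 0`, `|abcde − T_Ra·T_Rb·T_Rc·T_Rd·T_Re| ≤ (a⁶ + b⁶ + c⁶ + d⁶ + e⁶)∕R`. [folklore] -/
theorem quint_sub_clamp_quint_abs_le {R : ℝ} (hR : 0 < R) (a b c d e : ℝ) :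
    |a * b * c * d * e - max (-R) (min R a) * max (-R) (min R b) * max (-R) (min R c) * max (-R) (min R d) * max (-R) (min R e)| ≤
      (a ^ 6 + b ^ 6 + c ^ 6 + d ^ 6 + e ^ 6) / R := by
  -- the clamp facts (the tree's `abs_clamp_le_abs`, `abs_sub_clamp_le_sq_div`, inlined)
  have hshrink : ∀ w : ℝ, |max (-R) (min R w)| ≤ |w| := fun w => by
    rcases le_or_gt w (-R) with h1 | h1
    · rw [min_eq_right (by linarith), max_eq_left h1, abs_of_nonpos (by linarith), abs_of_nonpos (by linarith)]; linarith
    · rcases le_or_gt w R with h2 | h2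
      · rw [min_eq_right h2, max_eq_right h1.le]
      · rw [min_eq_left h2.le, max_eq_right (by linarith), abs_of_nonneg hR.le, abs_of_pos (by linarith)]; linarith
  have hdef : ∀ w : ℝ, |w - max (-R) (min R w)| * R ≤ w ^ 2 := fun w => by
    rcases le_or_gt w (-R) with h1 | h1
    · rw [min_eq_right (by linarith), max_eq_left h1, abs_of_nonpos (by linarith)]; nlinarith
    · rcases le_or_gt w R with h2 | h2
      · rw [min_eq_right h2, max_eq_right h1.le, sub_self, abs_zero, zero_mul]; positivity
      · rw [min_eq_left h2.le, max_eq_right (by linarith), abs_of_nonneg (by linarith)]; nlinarith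
  set A := max (-R) (min R a) with hA
  set B := max (-R) (min R b) with hB
  set C := max (-R) (min R c) with hC
  set D := max (-R) (min R d) with hD
  set E := max (-R) (min R e) with hE
  -- telescoping
  have tel : a * b * c * d * e - A * B * C * D * E = (a - A) * b * c * d * e + A * (b - B) * c * d * e + A * B * (c - C) * d * e +
      A * B * C * (d - D) * e + A * B * C * D * (e - E) := by ring
  rw [tel]
  have hAa := hshrink a; have hBb := hshrink b; have hCc := hshrink c; have hDd := hshrink d
  have t1 : |(a - A) * b * c * d * e| * R ≤ a ^ 2 * |b| * |c| * |d| * |e| := by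
    rw [abs_mul, abs_mul, abs_mul, abs_mul]
    calc |a - A| * |b| * |c| * |d| * |e| * R = |a - A| * R * (|b| * |c| * |d| * |e|) := by ring
      _ ≤ a ^ 2 * (|b| * |c| * |d| * |e|) := mul_le_mul_of_nonneg_right (hdef a) (by positivity)
      _ = a ^ 2 * |b| * |c| * |d| * |e| := by ring
  have t2 : |A * (b - B) * c * d * e| * R ≤ b ^ 2 * |a| * |c| * |d| * |e| := by
    rw [abs_mul, abs_mul, abs_mul, abs_mul]
    calc |A| * |b - B| * |c| * |d| * |e| * R = |b - B| * R * (|A| * (|c| * |d| * |e|)) := by ring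
      _ ≤ b ^ 2 * (|a| * (|c| * |d| * |e|)) :=
          mul_le_mul (hdef b) (mul_le_mul_of_nonneg_right hAa (by positivity)) (by positivity) (sq_nonneg _)
      _ = b ^ 2 * |a| * |c| * |d| * |e| := by ring
  have t3 : |A * B * (c - C) * d * e| * R ≤ c ^ 2 * |a| * |b| * |d| * |e| := by
    rw [abs_mul, abs_mul, abs_mul, abs_mul]
    have hAB : |A| * |B| ≤ |a| * |b| := mul_le_mul hAa hBb (abs_nonneg _) (abs_nonneg _)
    calc |A| * |B| * |c - C| * |d| * |e| * R = |c - C| * R * (|A| * |B| * (|d| * |e|)) := by ring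
      _ ≤ c ^ 2 * (|a| * |b| * (|d| * |e|)) :=
          mul_le_mul (hdef c) (mul_le_mul_of_nonneg_right hAB (by positivity)) (by positivity) (sq_nonneg _)
      _ = c ^ 2 * |a| * |b| * |d| * |e| := by ring
  have t4 : |A * B * C * (d - D) * e| * R ≤ d ^ 2 * |a| * |b| * |c| * |e| := by
    rw [abs_mul, abs_mul, abs_mul, abs_mul]
    have hABC : |A| * |B| * |C| ≤ |a| * |b| * |c| :=
      mul_le_mul (mul_le_mul hAa hBb (abs_nonneg _) (abs_nonneg _)) hCc (abs_nonneg _) (by positivity)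
    calc |A| * |B| * |C| * |d - D| * |e| * R = |d - D| * R * (|A| * |B| * |C| * |e|) := by ring
      _ ≤ d ^ 2 * (|a| * |b| * |c| * |e|) :=
          mul_le_mul (hdef d) (mul_le_mul_of_nonneg_right hABC (abs_nonneg _)) (by positivity) (sq_nonneg _)
      _ = d ^ 2 * |a| * |b| * |c| * |e| := by ring
  have t5 : |A * B * C * D * (e - E)| * R ≤ e ^ 2 * |a| * |b| * |c| * |d| := by
    rw [abs_mul, abs_mul, abs_mul, abs_mul]
    have hABCD : |A| * |B| * |C| * |D| ≤ |a| * |b| * |c| * |d| :=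
      mul_le_mul (mul_le_mul (mul_le_mul hAa hBb (abs_nonneg _) (abs_nonneg _)) hCc (abs_nonneg _) (by positivity)) hDd (abs_nonneg _)
        (by positivity)
    calc |A| * |B| * |C| * |D| * |e - E| * R = |e - E| * R * (|A| * |B| * |C| * |D|) := by ring
      _ ≤ e ^ 2 * (|a| * |b| * |c| * |d|) := mul_le_mul (hdef e) hABCD (by positivity) (sq_nonneg _)
      _ = e ^ 2 * |a| * |b| * |c| * |d| := by ring
  -- the five weighted means
  have s1 := sq_mul_abs_four_le a b c d e
  have s2 := sq_mul_abs_four_le b a c d e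
  have s3 := sq_mul_abs_four_le c a b d e
  have s4 := sq_mul_abs_four_le d a b c e
  have s5 := sq_mul_abs_four_le e a b c d
  rw [le_div_iff₀ hR]
  have tri : |(a - A) * b * c * d * e + A * (b - B) * c * d * e + A * B * (c - C) * d * e + A * B * C * (d - D) * e + A * B * C * D * (e - E)| ≤
      |(a - A) * b * c * d * e| + |A * (b - B) * c * d * e| + |A * B * (c - C) * d * e| + |A * B * C * (d - D) * e| +
        |A * B * C * D * (e - E)| := by
    have h1 := abs_add_le ((a - A) * b * c * d * e + A * (b - B) * c * d * e + A * B * (c - C) * d * e + A * B * C * (d - D) * e)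
      (A * B * C * D * (e - E))
    have h2 := abs_add_le ((a - A) * b * c * d * e + A * (b - B) * c * d * e + A * B * (c - C) * d * e) (A * B * C * (d - D) * e)
    have h3 := abs_add_le ((a - A) * b * c * d * e + A * (b - B) * c * d * e) (A * B * (c - C) * d * e)
    have h4 := abs_add_le ((a - A) * b * c * d * e) (A * (b - B) * c * d * e)
    linarith
  have triR := mul_le_mul_of_nonneg_right tri hR.le
  linarith

/-! ## §2. Expectations under a probability measure -/

variable {Ω : Type*} [MeasurableSpace Ω] {μ : Measure Ω} {f g h k l : Ω → ℝ}

/-- **`fghkl` is integrable** (fourth and sixth moments). [folklore] -/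
theorem integrable_quint [IsProbabilityMeasure μ] (hf : Measurable f) (hg : Measurable g) (hh : Measurable h) (hk : Measurable k)
    (hl : Measurable l) (hf6 : Integrable (fun ω => f ω ^ 6) μ) (hg6 : Integrable (fun ω => g ω ^ 6) μ) (hh6 : Integrable (fun ω => h ω ^ 6) μ)
    (hk4 : Integrable (fun ω => k ω ^ 4) μ) (hl4 : Integrable (fun ω => l ω ^ 4) μ) :
    Integrable (fun ω => f ω * g ω * h ω * k ω * l ω) μ := by
  refine (((((hf6.add hg6).add hh6).div_const 3).add ((hk4.add hl4).div_const 2)).div_const 2).mono'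
    ((((hf.mul hg).mul hh).mul hk).mul hl).aestronglyMeasurable (ae_of_all _ fun ω => ?_)
  rw [Real.norm_eq_abs]
  simpa using abs_quint_le (f ω) (g ω) (h ω) (k ω) (l ω)

/-- **The clamped product `ΠT_Rf` is integrable** (`R ≥ 0`; dominated by the unclamped moments). [folklore] -/
theorem integrable_quint_clamped [IsProbabilityMeasure μ] (hf : Measurable f) (hg : Measurable g) (hh : Measurable h) (hk : Measurable k)
    (hl : Measurable l) {R : ℝ} (hR : 0 ≤ R) (hf6 : Integrable (fun ω => f ω ^ 6) μ) (hg6 : Integrable (fun ω => g ω ^ 6) μ)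
    (hh6 : Integrable (fun ω => h ω ^ 6) μ) (hk4 : Integrable (fun ω => k ω ^ 4) μ) (hl4 : Integrable (fun ω => l ω ^ 4) μ) :
    Integrable (fun ω => max (-R) (min R (f ω)) * max (-R) (min R (g ω)) * max (-R) (min R (h ω)) * max (-R) (min R (k ω)) *
      max (-R) (min R (l ω))) μ := by
  have hm : ∀ {φ : Ω → ℝ}, Measurable φ → Measurable fun ω => max (-R) (min R (φ ω)) := fun hφ => measurable_const.max (measurable_const.min hφ)
  have hshrink : ∀ w : ℝ, |max (-R) (min R w)| ≤ |w| := fun w => by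
    rcases le_or_gt w (-R) with h1 | h1
    · rw [min_eq_right (by linarith), max_eq_left h1, abs_of_nonpos (by linarith), abs_of_nonpos (by linarith)]; linarith
    · rcases le_or_gt w R with h2 | h2
      · rw [min_eq_right h2, max_eq_right h1.le]
      · rw [min_eq_left h2.le, max_eq_right (by linarith), abs_of_nonneg hR, abs_of_pos (by linarith)]; linarith
  refine (((((hf6.add hg6).add hh6).div_const 3).add ((hk4.add hl4).div_const 2)).div_const 2).mono'
    (((((hm hf).mul (hm hg)).mul (hm hh)).mul (hm hk)).mul (hm hl)).aestronglyMeasurable (ae_of_all _ fun ω => ?_)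
  rw [Real.norm_eq_abs, abs_mul, abs_mul, abs_mul, abs_mul]
  have hq := abs_quint_le (f ω) (g ω) (h ω) (k ω) (l ω)
  rw [abs_mul, abs_mul, abs_mul, abs_mul] at hq
  have h1 := hshrink (f ω); have h2 := hshrink (g ω); have h3 := hshrink (h ω); have h4 := hshrink (k ω); have h5 := hshrink (l ω)
  have hprod : |max (-R) (min R (f ω))| * |max (-R) (min R (g ω))| * |max (-R) (min R (h ω))| * |max (-R) (min R (k ω))| *
      |max (-R) (min R (l ω))| ≤ |f ω| * |g ω| * |h ω| * |k ω| * |l ω| :=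
    mul_le_mul (mul_le_mul (mul_le_mul (mul_le_mul h1 h2 (abs_nonneg _) (abs_nonneg _)) h3 (abs_nonneg _) (by positivity)) h4 (abs_nonneg _)
      (by positivity)) h5 (abs_nonneg _) (by positivity)
  simpa using hprod.trans hq

/-- **THE FIVE-FACTOR DEFECT IN EXPECTATION**: `|∫fghkl − ∫ΠT_R·| ≤ (Σ∫f⁶)∕R`. [folklore] -/
theorem quint_expect_defect_le [IsProbabilityMeasure μ] (hf : Measurable f) (hg : Measurable g) (hh : Measurable h) (hk : Measurable k)
    (hl : Measurable l) {R : ℝ} (hR : 0 < R) (hf6 : Integrable (fun ω => f ω ^ 6) μ) (hg6 : Integrable (fun ω => g ω ^ 6) μ)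
    (hh6 : Integrable (fun ω => h ω ^ 6) μ) (hk6 : Integrable (fun ω => k ω ^ 6) μ) (hl6 : Integrable (fun ω => l ω ^ 6) μ)
    (hk4 : Integrable (fun ω => k ω ^ 4) μ) (hl4 : Integrable (fun ω => l ω ^ 4) μ) :
    |(∫ ω, f ω * g ω * h ω * k ω * l ω ∂μ) - ∫ ω, max (-R) (min R (f ω)) * max (-R) (min R (g ω)) * max (-R) (min R (h ω)) *
        max (-R) (min R (k ω)) * max (-R) (min R (l ω)) ∂μ| ≤
      ((∫ ω, f ω ^ 6 ∂μ) + (∫ ω, g ω ^ 6 ∂μ) + (∫ ω, h ω ^ 6 ∂μ) + (∫ ω, k ω ^ 6 ∂μ) + (∫ ω, l ω ^ 6 ∂μ)) / R := by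
  have hI := integrable_quint hf hg hh hk hl hf6 hg6 hh6 hk4 hl4
  have hIT := integrable_quint_clamped hf hg hh hk hl hR.le hf6 hg6 hh6 hk4 hl4
  rw [← integral_sub hI hIT]
  have h6a : Integrable (fun ω => f ω ^ 6 + g ω ^ 6) μ := hf6.add hg6
  have h6b : Integrable (fun ω => f ω ^ 6 + g ω ^ 6 + h ω ^ 6) μ := h6a.add hh6
  have h6c : Integrable (fun ω => f ω ^ 6 + g ω ^ 6 + h ω ^ 6 + k ω ^ 6) μ := h6b.add hk6
  have h6d : Integrable (fun ω => f ω ^ 6 + g ω ^ 6 + h ω ^ 6 + k ω ^ 6 + l ω ^ 6) μ := h6c.add hl6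
  have hbound : Integrable (fun ω => (f ω ^ 6 + g ω ^ 6 + h ω ^ 6 + k ω ^ 6 + l ω ^ 6) / R) μ := h6d.div_const R
  refine (abs_integral_le_integral_abs).trans ((integral_mono_of_nonneg (ae_of_all _ fun ω => abs_nonneg _) hbound
    (ae_of_all _ fun ω => quint_sub_clamp_quint_abs_le hR (f ω) (g ω) (h ω) (k ω) (l ω))).trans (le_of_eq ?_))
  rw [integral_div, integral_add h6c hl6, integral_add h6b hk6, integral_add h6a hh6, integral_add hf6 hg6]

/-- **THE RE-CENTRING COST OF A CLAMP**: if `∫f = 0` then `|∫T_Rf| ≤ ∫f²∕R` (`R > 0`). [folklore] -/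
theorem abs_expect_clamp_le [IsProbabilityMeasure μ] (hf : Measurable f) {R : ℝ} (hR : 0 < R) (hf4 : Integrable (fun ω => f ω ^ 4) μ)
    (hf0 : ∫ ω, f ω ∂μ = 0) : |∫ ω, max (-R) (min R (f ω)) ∂μ| ≤ (∫ ω, f ω ^ 2 ∂μ) / R := by
  have hf2 := integrable_sq_of_quartic hf hf4
  have hdef : ∀ w : ℝ, |w - max (-R) (min R w)| * R ≤ w ^ 2 := fun w => by
    rcases le_or_gt w (-R) with h1 | h1
    · rw [min_eq_right (by linarith), max_eq_left h1, abs_of_nonpos (by linarith)]; nlinarith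
    · rcases le_or_gt w R with h2 | h2
      · rw [min_eq_right h2, max_eq_right h1.le, sub_self, abs_zero, zero_mul]; positivity
      · rw [min_eq_left h2.le, max_eq_right (by linarith), abs_of_nonneg (by linarith)]; nlinarith
  -- `f` and `T_Rf` are integrable (`|f| ≤ (f² + 1)/2`, `|T_Rf| ≤ R`)
  have hfi : Integrable f μ := by
    refine ((hf2.add (integrable_const 1)).div_const 2).mono' hf.aestronglyMeasurable (ae_of_all _ fun ω => ?_)
    rw [Real.norm_eq_abs]
    have : |f ω| ≤ (f ω ^ 2 + 1) / 2 := by nlinarith [sq_nonneg (|f ω| - 1), sq_abs (f ω)]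
    simpa using this
  have hTi : Integrable (fun ω => max (-R) (min R (f ω))) μ := by
    refine (integrable_const R).mono' (measurable_const.max (measurable_const.min hf)).aestronglyMeasurable (ae_of_all _ fun ω => ?_)
    rw [Real.norm_eq_abs, abs_le]
    exact ⟨by simp, max_le (by linarith) (min_le_left _ _)⟩
  have e : (∫ ω, max (-R) (min R (f ω)) ∂μ) = -∫ ω, (f ω - max (-R) (min R (f ω))) ∂μ := by
    rw [integral_sub hfi hTi, hf0, zero_sub, neg_neg]
  rw [e, abs_neg]
  have hb : Integrable (fun ω => f ω ^ 2 / R) μ := hf2.div_const R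
  refine (abs_integral_le_integral_abs).trans ((integral_mono_of_nonneg (ae_of_all _ fun ω => abs_nonneg _) hb
    (ae_of_all _ fun ω => ?_)).trans (le_of_eq ?_))
  · have h := hdef (f ω)
    have : |f ω - max (-R) (min R (f ω))| ≤ f ω ^ 2 / R := by rw [le_div_iff₀ hR]; exact h
    simpa using this
  · rw [integral_div]

/-! ## §3. Toy -/

/-- Toy (§1 at `a = b = c = d = e = 1`): `1·1·1·1·1 ≤ (2 + 1 + 1 + 1 + 1)/6`. -/
example : (1 : ℝ) ^ 2 * |(1 : ℝ)| * |(1 : ℝ)| * |(1 : ℝ)| * |(1 : ℝ)| ≤ (2 * 1 ^ 6 + 1 ^ 6 + 1 ^ 6 + 1 ^ 6 + 1 ^ 6) / 6 := sq_mul_abs_four_le 1 1 1 1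
    1

end Summit.QuantumFields.BalabanUV.T4Continuum.NE7b.SupTruncationFiveBound

end
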